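import Mathlib.Algebra.Order.Chebyshev
import Mathlib.Analysis.SpecialFunctions.Trigonometric.Basic
import Summits.QuantumFields.YangMills.Theorems.EquipartitionCriticalityEquipartitionPinsProbeTangentUiLimit
import HarnessLib

/-!
# The single-edge Stein identities pass to the weak limit

Crux `stmt-QuantumFields-8760`
(`Summit.QuantumFields.YangMills.Theses.EquipartitionCriticality.EquipartitionPinsProbe`), line
`Sketch`, stub `stub_steinSingleEdgeLimit` (TS8).

Setting: probability measures `ν_k`, `τ` on the `ℝ^D`-valued `2`-cochains
`Ω := ZdPlaquette 4 → Fin D → ℝ` of `ℤ⁴` (product topology and σ-algebra) with `ν_k → τ` weakly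
(convergence of `∫ f` for every bounded continuous `f : Ω → ℝ`), coordinate second moments
`∫ (Y p a)² dν_k` bounded uniformly in `k` and `∫ (Y p a)² dτ ≤ B`. For a finite set of plaquettes
`S`, coefficients `h`, `c` and a colour index `b` put `L Y := ∑_{p ∈ S} ∑_a h p a · Y p a`,
`ℓ Y := ∑_{p ∈ S} c p · Y p b`, `κ := ∑_{p ∈ S} c p · h p b`. If the two linearised
Schwinger–Dyson (Stein) defects `|κ ∫ sin L dν_k + ∫ cos L · ℓ dν_k|` and
`|∫ sin L · ℓ dν_k - κ ∫ cos L dν_k|` are eventually `≤ η` for every `η > 0`, then under `τ`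
the identities hold exactly: `∫ cos L · ℓ dτ = -κ ∫ sin L dτ` and `∫ sin L · ℓ dτ = κ ∫ cos L dτ`.

Proof: `sin L`, `cos L` are bounded continuous, so their integrals converge by weak convergence;
the weighted integrals `∫ cos L · ℓ dν_k`, `∫ sin L · ℓ dν_k` converge by the landed stub TS6
(`TangentUiLimit.tendsto_integral_mul_of_weakLimit`, uniform integrability from a common `L²`
bound on `ℓ`), the common bound coming from Cauchy–Schwarz
`ℓ(Y)² ≤ #S · ∑_{p ∈ S} (c p)² (Y p b)²` (`sq_sum_le_card_mul_sum_sq`) and the coordinate second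
moments (`TangentSteinSingleEdgeLimit.integrable_sq_sum_and_integral_le`). Hence both defects
converge to the corresponding `τ`-expressions, whose absolute values are `≤ η` for every `η > 0`
(`le_of_tendsto`), i.e. vanish. Pure measure theory; no gauge theory enters.
-/

noncomputable section

open MeasureTheory Filter Topology
open Literature.MathematicalPhysics.QuantumLattice

namespace Summit.QuantumFields.YangMills.Theorems.EquipartitionPinsProbe

namespace TangentSteinSingleEdgeLimit

/-- **`L²` bound for a finite linear combination.** If `∫ (X i)² dμ ≤ K i` for `i ∈ S` (with
`(X i)²` integrable) and `(∑_{i ∈ S} w i · X i)²` is a.e. strongly measurable, then it is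
integrable with `∫ (∑_{i ∈ S} w i · X i)² dμ ≤ #S · ∑_{i ∈ S} (w i)² · K i`
(Cauchy–Schwarz `sq_sum_le_card_mul_sum_sq` pointwise, then dominated by the integrable
`#S · ∑ (w i)² (X i)²`). -/
theorem integrable_sq_sum_and_integral_le {Ω ι : Type*} [MeasurableSpace Ω] {μ : Measure Ω}
    (S : Finset ι) (w : ι → ℝ) (X : ι → Ω → ℝ) (K : ι → ℝ)
    (hX : ∀ i ∈ S, Integrable (fun Y => (X i Y) ^ 2) μ ∧ ∫ Y, (X i Y) ^ 2 ∂μ ≤ K i)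
    (hm : AEStronglyMeasurable (fun Y => (∑ i ∈ S, w i * X i Y) ^ 2) μ) :
    Integrable (fun Y => (∑ i ∈ S, w i * X i Y) ^ 2) μ ∧
      ∫ Y, (∑ i ∈ S, w i * X i Y) ^ 2 ∂μ ≤ S.card * ∑ i ∈ S, (w i) ^ 2 * K i := by
  -- the dominating function
  have hG : Integrable (fun Y => (S.card : ℝ) * ∑ i ∈ S, (w i) ^ 2 * (X i Y) ^ 2) μ :=
    (integrable_finsetSum S fun i hi => (hX i hi).1.const_mul ((w i) ^ 2)).const_mul _
  have hdom : ∀ Y, (∑ i ∈ S, w i * X i Y) ^ 2 ≤ (S.card : ℝ) * ∑ i ∈ S, (w i) ^ 2 * (X i Y) ^ 2 :=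
    fun Y => by
    calc (∑ i ∈ S, w i * X i Y) ^ 2 ≤ S.card * ∑ i ∈ S, (w i * X i Y) ^ 2 :=
          sq_sum_le_card_mul_sum_sq
      _ = S.card * ∑ i ∈ S, (w i) ^ 2 * (X i Y) ^ 2 := by simp_rw [mul_pow]
  have hI : Integrable (fun Y => (∑ i ∈ S, w i * X i Y) ^ 2) μ :=
    hG.mono' hm (ae_of_all _ fun Y => by
      rw [Real.norm_eq_abs, abs_of_nonneg (sq_nonneg _)]
      exact hdom Y)
  refine ⟨hI, ?_⟩
  calc ∫ Y, (∑ i ∈ S, w i * X i Y) ^ 2 ∂μ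
        ≤ ∫ Y, (S.card : ℝ) * ∑ i ∈ S, (w i) ^ 2 * (X i Y) ^ 2 ∂μ := integral_mono hI hG hdom
    _ = S.card * ∑ i ∈ S, (w i) ^ 2 * ∫ Y, (X i Y) ^ 2 ∂μ := by
        rw [integral_const_mul, integral_finsetSum S fun i hi => (hX i hi).1.const_mul ((w i) ^ 2)]
        simp_rw [integral_const_mul]
    _ ≤ S.card * ∑ i ∈ S, (w i) ^ 2 * K i := by
        gcongr with i hi
        exact (hX i hi).2

/-- **Common `L²` bound for `ℓ Y := ∑_{p ∈ S} c p · Y p b`** under all `ν k` and under `τ`, from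
coordinate second moments bounded uniformly in `k` (constants chosen per coordinate) and under `τ`
(constant `B`): take `C := #S · ∑_{p ∈ S} (c p)² · max (C_ν p b) B`
(`integrable_sq_sum_and_integral_le`; `ℓ²` is continuous hence measurable on the countable
product `Ω`). -/
theorem sq_moment_common_bound {D : ℕ} {ν : ℕ → Measure (ZdPlaquette 4 → Fin D → ℝ)}
    {τ : Measure (ZdPlaquette 4 → Fin D → ℝ)}
    (hν2 : ∀ (p : ZdPlaquette 4) (a : Fin D), ∃ C : ℝ, ∀ k : ℕ,
        Integrable (fun Y => (Y p a) ^ 2) (ν k) ∧ ∫ Y, (Y p a) ^ 2 ∂(ν k) ≤ C)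
    (hτ2 : ∃ B : ℝ, ∀ (p : ZdPlaquette 4) (a : Fin D),
        Integrable (fun Y => (Y p a) ^ 2) τ ∧ ∫ Y, (Y p a) ^ 2 ∂τ ≤ B)
    (S : Finset (ZdPlaquette 4)) (c : ZdPlaquette 4 → ℝ) (b : Fin D) :
    ∃ C : ℝ, (∀ k, Integrable (fun Y => (∑ p ∈ S, c p * Y p b) ^ 2) (ν k) ∧
        ∫ Y, (∑ p ∈ S, c p * Y p b) ^ 2 ∂(ν k) ≤ C) ∧
      Integrable (fun Y => (∑ p ∈ S, c p * Y p b) ^ 2) τ ∧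
        ∫ Y, (∑ p ∈ S, c p * Y p b) ^ 2 ∂τ ≤ C := by
  choose Cν hCν using hν2
  obtain ⟨B, hB⟩ := hτ2
  have hc : Continuous fun Y : ZdPlaquette 4 → Fin D → ℝ => (∑ p ∈ S, c p * Y p b) ^ 2 := by
    fun_prop
  refine ⟨S.card * ∑ p ∈ S, (c p) ^ 2 * max (Cν p b) B, fun k => ?_, ?_⟩
  · obtain ⟨hi, hle⟩ := integrable_sq_sum_and_integral_le (μ := ν k) S c (fun p Y => Y p b)
      (fun p => Cν p b) (fun p _ => hCν p b k) hc.aestronglyMeasurable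
    refine ⟨hi, hle.trans ?_⟩
    gcongr
    exact le_max_left _ _
  · obtain ⟨hi, hle⟩ := integrable_sq_sum_and_integral_le (μ := τ) S c (fun p Y => Y p b)
      (fun _ => B) (fun p _ => hB p b) hc.aestronglyMeasurable
    refine ⟨hi, hle.trans ?_⟩
    gcongr
    exact le_max_right _ _

/-- **Limit passage in the two Stein defects.** On a measurable space with a topology whose open
sets are measurable, let finite measures `ν k → τ` against bounded continuous functions, `L`, `ℓ`
continuous with a common bound on `∫ ℓ² dν_k`, `∫ ℓ² dτ`, and suppose the defects
`|κ ∫ sin L dν_k + ∫ cos L · ℓ dν_k|`, `|∫ sin L · ℓ dν_k - κ ∫ cos L dν_k|` are eventually `≤ η`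
for every `η > 0`. Then `∫ cos L · ℓ dτ = -κ ∫ sin L dτ` and `∫ sin L · ℓ dτ = κ ∫ cos L dτ`:
all four integrals converge (`sin L`, `cos L` bounded continuous; the weighted ones by
`TangentUiLimit.tendsto_integral_mul_of_weakLimit`), so the limiting defects are `≤ η` for all
`η > 0` (`le_of_tendsto`), hence zero. -/
theorem limit_identities {Ω : Type*} [MeasurableSpace Ω] [TopologicalSpace Ω]
    [OpensMeasurableSpace Ω] {ν : ℕ → Measure Ω} {τ : Measure Ω}
    [∀ k, IsFiniteMeasure (ν k)] [IsFiniteMeasure τ]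
    (hweak : ∀ f : Ω → ℝ, Continuous f → (∃ C : ℝ, ∀ Y, |f Y| ≤ C) →
      Tendsto (fun k : ℕ => ∫ Y, f Y ∂(ν k)) atTop (𝓝 (∫ Y, f Y ∂τ)))
    {L ℓ : Ω → ℝ} (hLc : Continuous L) (hℓc : Continuous ℓ)
    (hL2 : ∃ C : ℝ, (∀ k, Integrable (fun Y => (ℓ Y) ^ 2) (ν k) ∧ ∫ Y, (ℓ Y) ^ 2 ∂(ν k) ≤ C) ∧
      Integrable (fun Y => (ℓ Y) ^ 2) τ ∧ ∫ Y, (ℓ Y) ^ 2 ∂τ ≤ C)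
    (κ : ℝ)
    (hdef : ∀ η : ℝ, 0 < η → ∀ᶠ k : ℕ in atTop,
      |κ * (∫ Y, Real.sin (L Y) ∂(ν k)) + ∫ Y, Real.cos (L Y) * ℓ Y ∂(ν k)| ≤ η ∧
      |(∫ Y, Real.sin (L Y) * ℓ Y ∂(ν k)) - κ * ∫ Y, Real.cos (L Y) ∂(ν k)| ≤ η) :
    (∫ Y, Real.cos (L Y) * ℓ Y ∂τ = -κ * ∫ Y, Real.sin (L Y) ∂τ) ∧
    (∫ Y, Real.sin (L Y) * ℓ Y ∂τ = κ * ∫ Y, Real.cos (L Y) ∂τ) := by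
  have hsc : Continuous fun Y => Real.sin (L Y) := Real.continuous_sin.comp hLc
  have hcc : Continuous fun Y => Real.cos (L Y) := Real.continuous_cos.comp hLc
  have hsb : ∃ C : ℝ, ∀ Y, |Real.sin (L Y)| ≤ C := ⟨1, fun Y => Real.abs_sin_le_one _⟩
  have hcb : ∃ C : ℝ, ∀ Y, |Real.cos (L Y)| ≤ C := ⟨1, fun Y => Real.abs_cos_le_one _⟩
  have T1 : Tendsto (fun k => ∫ Y, Real.sin (L Y) ∂(ν k)) atTop (𝓝 (∫ Y, Real.sin (L Y) ∂τ)) :=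
    hweak _ hsc hsb
  have T2 : Tendsto (fun k => ∫ Y, Real.cos (L Y) ∂(ν k)) atTop (𝓝 (∫ Y, Real.cos (L Y) ∂τ)) :=
    hweak _ hcc hcb
  have T3 : Tendsto (fun k => ∫ Y, Real.cos (L Y) * ℓ Y ∂(ν k)) atTop
      (𝓝 (∫ Y, Real.cos (L Y) * ℓ Y ∂τ)) :=
    TangentUiLimit.tendsto_integral_mul_of_weakLimit hweak hcc hcb hℓc hL2
  have T4 : Tendsto (fun k => ∫ Y, Real.sin (L Y) * ℓ Y ∂(ν k)) atTop
      (𝓝 (∫ Y, Real.sin (L Y) * ℓ Y ∂τ)) :=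
    TangentUiLimit.tendsto_integral_mul_of_weakLimit hweak hsc hsb hℓc hL2
  have TA := ((T1.const_mul κ).add T3).abs
  have TB := (T4.sub (T2.const_mul κ)).abs
  have hA : ∀ η : ℝ, 0 < η →
      |κ * (∫ Y, Real.sin (L Y) ∂τ) + ∫ Y, Real.cos (L Y) * ℓ Y ∂τ| ≤ η := fun η hη =>
    le_of_tendsto TA ((hdef η hη).mono fun k hk => hk.1)
  have hB : ∀ η : ℝ, 0 < η →
      |(∫ Y, Real.sin (L Y) * ℓ Y ∂τ) - κ * ∫ Y, Real.cos (L Y) ∂τ| ≤ η := fun η hη =>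
    le_of_tendsto TB ((hdef η hη).mono fun k hk => hk.2)
  have hA0 : κ * (∫ Y, Real.sin (L Y) ∂τ) + ∫ Y, Real.cos (L Y) * ℓ Y ∂τ = 0 := by
    by_contra hne
    have h := hA _ (half_pos (abs_pos.mpr hne))
    linarith [abs_pos.mpr hne]
  have hB0 : (∫ Y, Real.sin (L Y) * ℓ Y ∂τ) - κ * ∫ Y, Real.cos (L Y) ∂τ = 0 := by
    by_contra hne
    have h := hB _ (half_pos (abs_pos.mpr hne))
    linarith [abs_pos.mpr hne]
  constructor
  · linear_combination hA0
  · linear_combination hB0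

end TangentSteinSingleEdgeLimit

/-- STUB `stub_steinSingleEdgeLimit` (TS8) — **the single-edge Stein identities pass to the weak
limit**: if probability measures `ν_k` on the `ℝ^D`-valued `2`-cochains of `ℤ⁴` converge weakly
(against bounded continuous functions) to `τ`, with coordinate second moments bounded uniformly in
`k` and under `τ`, and for `L Y := ∑_{p ∈ S} ∑_a h p a · Y p a`, `ℓ Y := ∑_{p ∈ S} c p · Y p b`,
`κ := ∑_{p ∈ S} c p · h p b` the defects `|κ ∫ sin L dν_k + ∫ cos L · ℓ dν_k|`,
`|∫ sin L · ℓ dν_k - κ ∫ cos L dν_k|` are eventually `≤ η` for every `η > 0`, then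
`∫ cos L · ℓ dτ = -κ ∫ sin L dτ` and `∫ sin L · ℓ dτ = κ ∫ cos L dτ`
(`TangentSteinSingleEdgeLimit.limit_identities` with the common `L²` bound
`TangentSteinSingleEdgeLimit.sq_moment_common_bound`; weak convergence for the bounded continuous
`sin L`, `cos L`, the landed TS6 `TangentUiLimit.tendsto_integral_mul_of_weakLimit` for the
weighted terms, `le_of_tendsto`). -/
theorem stub_steinSingleEdgeLimit :
    ∀ (D : ℕ) (ν : ℕ → MeasureTheory.Measure (Literature.MathematicalPhysics.QuantumLattice.ZdPlaquette 4 → Fin D → ℝ))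
      (τ : MeasureTheory.Measure (Literature.MathematicalPhysics.QuantumLattice.ZdPlaquette 4 → Fin D → ℝ)),
      (∀ k, MeasureTheory.IsProbabilityMeasure (ν k)) → MeasureTheory.IsProbabilityMeasure τ →
      (∀ f : (Literature.MathematicalPhysics.QuantumLattice.ZdPlaquette 4 → Fin D → ℝ) → ℝ, Continuous f → (∃ C : ℝ, ∀ Y, |f Y| ≤ C) →
          Filter.Tendsto (fun k : ℕ => ∫ Y, f Y ∂(ν k)) Filter.atTop (nhds (∫ Y, f Y ∂τ))) →
      (∀ (p : Literature.MathematicalPhysics.QuantumLattice.ZdPlaquette 4) (a : Fin D), ∃ C : ℝ, ∀ k : ℕ,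
        MeasureTheory.Integrable (fun Y => (Y p a) ^ 2) (ν k) ∧ ∫ Y, (Y p a) ^ 2 ∂(ν k) ≤ C) →
      (∃ B : ℝ, ∀ (p : Literature.MathematicalPhysics.QuantumLattice.ZdPlaquette 4) (a : Fin D),
        MeasureTheory.Integrable (fun Y => (Y p a) ^ 2) τ ∧ ∫ Y, (Y p a) ^ 2 ∂τ ≤ B) →
      ∀ (S : Finset (Literature.MathematicalPhysics.QuantumLattice.ZdPlaquette 4)) (h : Literature.MathematicalPhysics.QuantumLattice.ZdPlaquette 4 → Fin D → ℝ)
        (c : Literature.MathematicalPhysics.QuantumLattice.ZdPlaquette 4 → ℝ) (b : Fin D),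
        (∀ η : ℝ, 0 < η → ∀ᶠ k : ℕ in Filter.atTop,
          |(∑ p ∈ S, c p * h p b) * (∫ Y, Real.sin (∑ p ∈ S, ∑ a : Fin D, h p a * Y p a) ∂(ν k)) +
              ∫ Y, Real.cos (∑ p ∈ S, ∑ a : Fin D, h p a * Y p a) * (∑ p ∈ S, c p * Y p b) ∂(ν k)| ≤ η ∧
          |(∫ Y, Real.sin (∑ p ∈ S, ∑ a : Fin D, h p a * Y p a) * (∑ p ∈ S, c p * Y p b) ∂(ν k)) -
              (∑ p ∈ S, c p * h p b) * ∫ Y, Real.cos (∑ p ∈ S, ∑ a : Fin D, h p a * Y p a) ∂(ν k)| ≤ η) →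
        (∫ Y, Real.cos (∑ p ∈ S, ∑ a : Fin D, h p a * Y p a) * (∑ p ∈ S, c p * Y p b) ∂τ =
            -(∑ p ∈ S, c p * h p b) * ∫ Y, Real.sin (∑ p ∈ S, ∑ a : Fin D, h p a * Y p a) ∂τ) ∧
        (∫ Y, Real.sin (∑ p ∈ S, ∑ a : Fin D, h p a * Y p a) * (∑ p ∈ S, c p * Y p b) ∂τ =
            (∑ p ∈ S, c p * h p b) * ∫ Y, Real.cos (∑ p ∈ S, ∑ a : Fin D, h p a * Y p a) ∂τ) := by
  intro D ν τ hν hτ hweak hν2 hτ2 S h c b hdef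
  haveI : ∀ k, IsProbabilityMeasure (ν k) := hν
  haveI : IsProbabilityMeasure τ := hτ
  have hLc : Continuous fun Y : ZdPlaquette 4 → Fin D → ℝ => ∑ p ∈ S, ∑ a : Fin D, h p a * Y p a := by
    fun_prop
  have hℓc : Continuous fun Y : ZdPlaquette 4 → Fin D → ℝ => ∑ p ∈ S, c p * Y p b := by
    fun_prop
  exact TangentSteinSingleEdgeLimit.limit_identities hweak hLc hℓc
    (TangentSteinSingleEdgeLimit.sq_moment_common_bound hν2 hτ2 S c b) (∑ p ∈ S, c p * h p b) hdef

end Summit.QuantumFields.YangMills.Theorems.EquipartitionPinsProbe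

end
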